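import Literature.NumberTheory.EllipticCurves.ZpExtensionEisensteinTwistLocalH1BoundProofs
import Literature.NumberTheory.EllipticCurves.IwasawaAlgebraEisensteinUniformIndexProofs
import HarnessLib

/-!
# `p^{8N} · H¹(F, E[p^j] ⊗ A_{m,j}(ψ)) = 0` for ALL levels `j` and ALL `m > 2N` — the `m`-uniform local torsion bound at a
# finitely decomposed place of residue characteristic `≠ p` (Howard H.4 / control at `v ∣ N`; proofs)

`Proofs` file (theorems only; no definition, no named fact, no instance) in topic `NumberTheory/EllipticCurves`; sequel of
`ZpExtensionEisensteinTwistLocalH1BoundProofs` (the `j`-uniform bound `#H¹(F, W_{m,j}) ≤ C(m)`), made UNIFORM IN `m` by the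
index bound `natCard_quotient_span_charTwistElement_le` (`#(S_m/(Δ̄_ℓ)) ≤ p^{2N}`, `IwasawaAlgebraEisensteinUniformIndexProofs`):

* `nsmul_eq_zero_of_isPrimaryTorsion_of_natCard_le_pow` — a finite `p`-primary group of order `≤ p^e` is killed by `p^e`;
* `subsingleton_eisensteinCoeff_zero`, `subsingleton_galoisCohomology_restrictField_eisensteinTwist_zero` — the level `j = 0`
  (`A_{m,0} = 0`) is trivial;
* **`ZpExtension.natCard_galoisCohomology_one_restrictField_eisensteinTwist_le_pow`**: `#H¹(F, E[p^j] ⊗ A_{m,j}(ψ)) ≤ p^{8N}`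
  for all `j ≥ 1`, `m > 2N` (`F` a `K`-field, non-archimedean local of characteristic `0`, residue characteristic `∤ p`, ONE
  `h ∈ Γ_F` with `κ(h) = N ≥ 1`);
* **`ZpExtension.pow_smul_galoisCohomology_one_restrictField_eisensteinTwist_eq_zero`**: `p^{8N} · H¹(F, W_{m,j}) = 0` for ALL
  `j` and all `m > 2N`; `exists_forall_pow_smul_galoisCohomology_one_eq_zero_uniform` (from one `h₀` with `κ(h₀) ≠ 1`);
* **`exists_forall_pow_smul_galoisCohomology_one_toLocal_eq_zero_uniform`**: at a finite place `v ∤ p` of a number field with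
  `¬ D_v ≤ ker κ`: `∃ N ≥ 1, ∀ m > 2N, ∀ j, p^{8N} · H¹(K_v, E[p^j] ⊗ A_{m,j}(ψ)) = 0` — the (hTX)/(hTY) inputs of the
  saturated descent (`Tower.levelCondition_mem_iff_forall_pairing_eq_zero_of_forall_nsmul_eq_zero`) with an exponent that does
  not depend on `m`: the shape the `m`-uniform control (cell `pub/bsd-print-x9`, STUB B) consumes.

References: [Howard2004HeegnerKolyvagin] B. Howard, Compositio Math. 140 (2004), §1.3 H.4, §2.2, Def. 3.1.2, Prop. 3.2.8;
[MilneADT2006] I Thm. 2.8; [Brink2007] Thm. 2, Cor. 1. BSD is not proved by any of this.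
-/

noncomputable section

open Field IsNonarchimedeanLocalField ValuativeRel
open scoped Classical TensorProduct

universe u

namespace Literature.NumberTheory.EllipticCurves

open Literature.NumberTheory.GaloisRepresentations Literature.NumberTheory.GaloisRepresentations.DiscreteGaloisModule
  IwasawaAlgebra IwasawaAlgebra.EisensteinCoeff Literature.Algebra.Module

/-! ## §1 Helpers: bounded `p`-primary groups; the level `j = 0` -/

section Uniform

open IwasawaAlgebra IwasawaAlgebra.EisensteinCoeff

/-- A finite `p`-primary group of order `≤ p^e` is killed by `p^e` (the order of an element is a power of `p` bounded by the
order of the group). [cite: MilneADT2006, I §0 (finite modules; folklore)] -/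
theorem nsmul_eq_zero_of_isPrimaryTorsion_of_natCard_le_pow {M : Type u} [AddCommGroup M] [Finite M] {p e : ℕ}
    (hp : p.Prime) (hM : IsPrimaryTorsion p M) (hc : Nat.card M ≤ p ^ e) (y : M) : p ^ e • y = 0 := by
  classical
  haveI : Fintype M := Fintype.ofFinite M
  obtain ⟨r, hr⟩ := hM y
  have hdvd : addOrderOf y ∣ p ^ r := addOrderOf_dvd_of_nsmul_eq_zero hr
  obtain ⟨a, -, ha⟩ := (Nat.dvd_prime_pow hp).1 hdvd
  have hle : p ^ a ≤ p ^ e := by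
    rw [← ha]
    exact (addOrderOf_le_card_univ (x := y)).trans (by rw [← Nat.card_eq_fintype_card]; exact hc)
  have hae : a ≤ e := (Nat.pow_le_pow_iff_right hp.one_lt).1 hle
  obtain ⟨d, hd⟩ := Nat.exists_eq_add_of_le hae
  rw [hd, pow_add, mul_comm, mul_smul, ← ha, addOrderOf_nsmul_eq_zero, smul_zero]

/-- `A_{m,0} = Λ/(q_m, p^0) = Λ/(1)` is the zero ring. [cite: Howard2004HeegnerKolyvagin, §2.2 (A_𝔮/p^k at k = 0)] -/
theorem subsingleton_eisensteinCoeff_zero (p : ℕ) [Fact p.Prime] (m : ℕ) : Subsingleton (EisensteinCoeff p m 0) := by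
  refine Ideal.Quotient.subsingleton_iff.mpr ?_
  rw [Ideal.eq_top_iff_one]
  refine Ideal.mem_sup_right (Ideal.subset_span ?_)
  simp

variable {K : Type u} [Field K] {p : ℕ} [hp : Fact p.Prime] (κ : ZpExtension K p) {m : ℕ} (hm : 1 ≤ m)
  {M : Type u} [AddCommGroup M] [TopologicalSpace M] [DiscreteTopology M] (ρ : DiscreteGaloisModule K M)
  (F : Type u) [Field F] [Algebra K F]

/-- At the level `j = 0` every (positive-degree) cohomology group of `M ⊗ A_{m,0}(ψ) = 0` vanishes. [cite: Howard2004HeegnerKolyvagin, §2.2] -/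
theorem subsingleton_galoisCohomology_restrictField_eisensteinTwist_zero (n : ℕ) :
    Subsingleton (galoisCohomology (GaloisRep.restrictField F (κ.eisensteinTwist ρ hm 0)) (n + 1)) := by
  haveI := subsingleton_eisensteinCoeff_zero p m
  haveI : Subsingleton (Twisted p m 0 M) := inferInstanceAs (Subsingleton (EisensteinCoeff p m 0 ⊗[ℤ] M))
  haveI : Subsingleton (GaloisRep.restrictField F (κ.eisensteinTwist ρ hm 0)).toTopRep := ‹Subsingleton (Twisted p m 0 M)›
  exact subsingleton_continuousCohomology_of_subsingleton (GaloisRep.restrictField F (κ.eisensteinTwist ρ hm 0)).toTopRep n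

end Uniform

namespace ZpExtension

variable {K : Type u} [Field K] (W : WeierstrassCurve K) [W.IsElliptic] {p : ℕ} [hp : Fact p.Prime]
  (κ : ZpExtension K p) {m : ℕ} (hm : 1 ≤ m)
  (F : Type u) [Field F] [Algebra K F] [CharZero F] [ValuativeRel F] [TopologicalSpace F] [IsNonarchimedeanLocalField F]

/-- **`#H¹(F, E[p^j] ⊗ A_{m,j}(ψ)) ≤ p^{8N}` for all `j ≥ 1` and all `m > 2N`** — the `m`-UNIFORM form of
`exists_natCard_galoisCohomology_one_restrictField_eisensteinTwist_le` (each of the two factors of the Euler characteristic is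
`≤ #(S_m/(Δ̄))² ≤ (p^{2N})²`, `natCard_quotient_span_charTwistElement_le`). [cite: Howard2004HeegnerKolyvagin, §1.3 H.4 and §2.2]
[cite: MilneADT2006, I Thm. 2.8 and Cor. 2.3] -/
theorem natCard_galoisCohomology_one_restrictField_eisensteinTwist_le_pow (hpK : (p : K) ≠ 0)
    (hFp : ¬ ringChar 𝓀[F] ∣ p) (h : absoluteGaloisGroup F) {N : ℕ} (hN : 1 ≤ N)
    (hσ : (κ (absGaloisRestrict K F h)).toAdd = (N : ℤ_[p])) (hmN : 2 * N < m) (j : ℕ) (hj : 1 ≤ j) :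
    Nat.card (galoisCohomology (GaloisRep.restrictField F
      (κ.eisensteinTwist (W.torsionGaloisModule ((p : ℤ) ^ j)) hm j)) 1) ≤ p ^ (8 * N) := by
  have hpp := hp.out
  haveI : NeZero (p : F) := ⟨fun h0 ↦ hpK (by
    exact (algebraMap K F).injective.eq_iff.mp (by rw [map_natCast, map_zero, h0]))⟩
  obtain ⟨a₁, a₀, ha₀, hD⟩ := κ.natCard_setOf_eisensteinTwist_apply_eq_smul_le W hm hpK hN hσ hmN
  set χ : ℤ_[p] := ((GaloisRep.cyclotomicCharacter F p h : ℤ_[p]ˣ) : ℤ_[p]) with hχ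
  obtain ⟨-, hb1⟩ := hD j hj 1
  obtain ⟨-, hbχ⟩ := hD j hj χ
  have hq1 := IwasawaAlgebra.natCard_quotient_span_charTwistElement_le p (m := m) a₁ 1 ha₀ hN hmN
  have hqχ := IwasawaAlgebra.natCard_quotient_span_charTwistElement_le p (m := m) a₁ χ ha₀ hN hmN
  haveI : NeZero (p ^ j) := ⟨pow_ne_zero j hpp.ne_zero⟩
  set ρ := κ.eisensteinTwist (W.torsionGaloisModule ((p : ℤ) ^ j)) hm j with hρ
  obtain ⟨e⟩ := nonempty_addEquiv_geomTorsion W p j hj hpK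
  have hidx : W.geomTorsion ((p ^ j : ℕ) : ℤ) = W.geomTorsion ((p : ℤ) ^ j) := by rw [Nat.cast_pow]
  haveI : Finite (Twisted p m j (W.geomTorsion ((p : ℤ) ^ j))) := by
    apply Nat.finite_of_card_ne_zero
    rw [Twisted.natCard_eq_of_addEquiv hm ((AddEquiv.addSubgroupCongr hidx).symm.trans e)]
    exact pow_ne_zero _ hpp.ne_zero
  have hM : ∀ w : Twisted p m j (W.geomTorsion ((p : ℤ) ^ j)), p ^ j • w = 0 := Twisted.pow_smul_eq_zero m j
  have hn : ¬ ringChar 𝓀[F] ∣ p ^ j := fun hd ↦ hFp ((ringChar_residueField_prime (F := F)).dvd_of_dvd_pow hd)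
  haveI := absoluteGaloisGroup_compactSpace F
  have h1 := natCard_one_eq_natCard_invariants_mul F (p ^ j) hn (GaloisRep.restrictField F ρ) hM
  change Nat.card (continuousCohomology 1 (GaloisRep.restrictField F ρ).toTopRep) ≤ _
  rw [h1, show 8 * N = 2 * N * 2 + 2 * N * 2 by ring, pow_add]
  refine Nat.mul_le_mul ?_ ?_
  · refine (natCard_invariants_restrictField_le_natCard_setOf ρ F h).trans ?_
    refine le_trans ?_ ((Nat.pow_le_pow_left hq1 2).trans_eq (by rw [← pow_mul]))
    simpa only [one_pow, mul_one, map_one, one_smul] using hb1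
  · have hc := mu_apply_eq_cyclotomicCharacterModPow_val_nsmul F h (p := p) j
    refine (natCard_invariants_homRep_mu_restrictField_le ρ F h hM hc).trans ?_
    refine le_trans ?_ ((Nat.pow_le_pow_left hqχ 2).trans_eq (by rw [← pow_mul]))
    have hcast : ∀ w : Twisted p m j (W.geomTorsion ((p : ℤ) ^ j)),
        (cyclotomicCharacterModPow F p j h).val • w = algebraMap ℤ_[p] (EisensteinCoeff p m j) χ • w := fun w ↦ by
      rw [EisensteinCoeff.algebraMap_padicInt_eq_ofZMod_toZModPow p hm j, EisensteinCoeff.ofZMod_apply, hχ,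
        ← cyclotomicCharacterModPow_apply, Nat.cast_smul_eq_nsmul]
    simp only [hcast, hρ]
    exact hbχ

/-- **`p^{8N} · H¹(F, E[p^j] ⊗ A_{m,j}(ψ)) = 0` for ALL `j` and all `m > 2N`** (the exponent is independent of `m` and of the
level; `j = 0` is the zero module). [cite: Howard2004HeegnerKolyvagin, §1.3 H.4, §2.2, Def. 3.1.2] [cite: MilneADT2006, I Thm. 2.8] -/
theorem pow_smul_galoisCohomology_one_restrictField_eisensteinTwist_eq_zero (hpK : (p : K) ≠ 0)
    (hFp : ¬ ringChar 𝓀[F] ∣ p) (h : absoluteGaloisGroup F) {N : ℕ} (hN : 1 ≤ N)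
    (hσ : (κ (absGaloisRestrict K F h)).toAdd = (N : ℤ_[p])) (hmN : 2 * N < m) (j : ℕ)
    (x : galoisCohomology (GaloisRep.restrictField F (κ.eisensteinTwist (W.torsionGaloisModule ((p : ℤ) ^ j)) hm j)) 1) :
    p ^ (8 * N) • x = 0 := by
  have hpp := hp.out
  rcases Nat.eq_zero_or_pos j with rfl | hj
  · haveI := subsingleton_galoisCohomology_restrictField_eisensteinTwist_zero κ hm (W.torsionGaloisModule ((p : ℤ) ^ 0)) F 0
    exact Subsingleton.elim _ _
  · obtain ⟨e⟩ := nonempty_addEquiv_geomTorsion W p j hj hpK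
    have hidx : W.geomTorsion ((p ^ j : ℕ) : ℤ) = W.geomTorsion ((p : ℤ) ^ j) := by rw [Nat.cast_pow]
    haveI : Finite (Twisted p m j (W.geomTorsion ((p : ℤ) ^ j))) := by
      apply Nat.finite_of_card_ne_zero
      rw [Twisted.natCard_eq_of_addEquiv hm ((AddEquiv.addSubgroupCongr hidx).symm.trans e)]
      exact pow_ne_zero _ hpp.ne_zero
    haveI : Finite (galoisCohomology (GaloisRep.restrictField F
        (κ.eisensteinTwist (W.torsionGaloisModule ((p : ℤ) ^ j)) hm j)) 1) :=
      finite_galoisCohomology_one_of_isNonarchimedeanLocalField _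
    have hM : ∀ w : Twisted p m j (W.geomTorsion ((p : ℤ) ^ j)), p ^ j • w = 0 := Twisted.pow_smul_eq_zero m j
    have hprim : IsPrimaryTorsion p (galoisCohomology (GaloisRep.restrictField F
        (κ.eisensteinTwist (W.torsionGaloisModule ((p : ℤ) ^ j)) hm j)) 1) := fun z ↦
      ⟨j, nsmul_continuousCohomology_one_eq_zero (GaloisRep.restrictField F
        (κ.eisensteinTwist (W.torsionGaloisModule ((p : ℤ) ^ j)) hm j)).toTopRep (p ^ j) hM z⟩
    exact nsmul_eq_zero_of_isPrimaryTorsion_of_natCard_le_pow hpp hprim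
      (κ.natCard_galoisCohomology_one_restrictField_eisensteinTwist_le_pow W hm F hpK hFp h hN hσ hmN j hj) x

/-- **From ONE non-trivial value of `κ` on `Γ_F`, uniformly**: there is `N ≥ 1` with `p^{8N} · H¹(F, E[p^j] ⊗ A_{m,j}(ψ)) = 0`
for ALL `j` and ALL `m > 2N`. [cite: Howard2004HeegnerKolyvagin, §1.3 H.4, §2.2, Def. 3.1.2] [cite: MilneADT2006, I Thm. 2.8] -/
theorem exists_forall_pow_smul_galoisCohomology_one_eq_zero_uniform (hpK : (p : K) ≠ 0)
    (hFp : ¬ ringChar 𝓀[F] ∣ p) (h₀ : absoluteGaloisGroup F) (hh₀ : κ (absGaloisRestrict K F h₀) ≠ 1) :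
    ∃ N : ℕ, 1 ≤ N ∧ ∀ (m : ℕ) (hm : 1 ≤ m), 2 * N < m → ∀ (j : ℕ)
      (x : galoisCohomology (GaloisRep.restrictField F
        (κ.eisensteinTwist (W.torsionGaloisModule ((p : ℤ) ^ j)) hm j)) 1), p ^ (8 * N) • x = 0 := by
  obtain ⟨e, h, hh⟩ := κ.exists_toAdd_apply_absGaloisRestrict_eq_pow F h₀ hh₀
  refine ⟨p ^ e, Nat.one_le_pow _ _ hp.out.pos, fun m hm hmN j x ↦ ?_⟩
  exact κ.pow_smul_galoisCohomology_one_restrictField_eisensteinTwist_eq_zero W hm F hpK hFp h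
    (Nat.one_le_pow _ _ hp.out.pos) hh hmN j x

end ZpExtension

/-! ### At a finite place `v ∤ p` of a number field, uniformly in `m` -/

section AdicCompletionUniform

open IsDedekindDomain NumberField
open scoped NumberField

variable {K : Type} [Field K] [NumberField K] (v : HeightOneSpectrum (𝓞 K))

/-- The residue characteristic of `K_v` does not divide `n` when `(n) ⊄ v` (a private copy of the tree's
`not_ringChar_residueField_adicCompletion_dvd`, whose imports are not wanted here). [folklore] -/
private theorem not_ringChar_residueField_adicCompletion_dvd_of_not_mem {n : ℕ}
    (hv : ((n : ℕ) : 𝓞 K) ∉ v.asIdeal) : ¬ ringChar 𝓀[v.adicCompletion K] ∣ n := by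
  rintro ⟨m, hm⟩
  set q := ringChar 𝓀[v.adicCompletion K] with hq
  have hqv : ((q : ℕ) : 𝓞 K) ∈ v.asIdeal := by
    by_contra hqv
    have h0 : ((q : ℕ) : 𝓀[v.adicCompletion K]) = 0 := (ringChar.spec 𝓀[v.adicCompletion K] q).2 dvd_rfl
    have h1 : ¬ IsUnit ((q : ℕ) : 𝒪[v.adicCompletion K]) := fun hu ↦ by
      have h' := hu.map (IsLocalRing.residue 𝒪[v.adicCompletion K])
      rw [map_natCast] at h'
      exact h'.ne_zero h0
    rw [Valuation.Integer.not_isUnit_iff_valuation_lt_one] at h1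
    have h2 : Valued.v (((q : ℕ) : 𝒪[v.adicCompletion K]) : v.adicCompletion K) < 1 :=
      (Valuation.vlt_one_iff
        (Valued.v : Valuation (v.adicCompletion K) (WithZero (Multiplicative ℤ)))).mp
        ((Valuation.vlt_one_iff (ValuativeRel.valuation (v.adicCompletion K))).mpr h1)
    have h3 : (((q : ℕ) : 𝒪[v.adicCompletion K]) : v.adicCompletion K) =
        ((algebraMap (𝓞 K) K q : K) : v.adicCompletion K) := by
      rw [SubringClass.coe_natCast, map_natCast]
      exact (map_natCast (algebraMap K (v.adicCompletion K)) q).symm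
    rw [h3, HeightOneSpectrum.valuedAdicCompletion_eq_valuation',
      HeightOneSpectrum.valuation_lt_one_iff_mem] at h2
    exact hqv h2
  apply hv
  have : ((n : ℕ) : 𝓞 K) = ((q : ℕ) : 𝓞 K) * ((m : ℕ) : 𝓞 K) := by rw [hm]; push_cast; ring
  rw [this]
  exact v.asIdeal.mul_mem_right _ hqv

/-- **Uniform torsion of `H¹(K_v, E[p^j] ⊗ A_{m,j}(ψ))` at a finite place `v ∤ p` not splitting completely in `K_∞`,
with an exponent independent of `m` and `j`**: `∃ N ≥ 1, ∀ m > 2N, ∀ j, p^{8N} · H¹(K_v, W_{m,j}) = 0`.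
[cite: Howard2004HeegnerKolyvagin, §1.3 H.4, §2.2, Def. 3.1.2] [cite: MilneADT2006, I Thm. 2.8] [cite: Brink2007, Thm. 2 and Cor. 1] -/
theorem exists_forall_pow_smul_galoisCohomology_one_toLocal_eq_zero_uniform (W : WeierstrassCurve K) [W.IsElliptic]
    {p : ℕ} [hp : Fact p.Prime] (κ : ZpExtension K p) (hv : ((p : ℕ) : 𝓞 K) ∉ v.asIdeal)
    (hdec : ¬ (GreenbergSelmer.decomp v ≤ κ.kerSubgroup)) :
    ∃ N : ℕ, 1 ≤ N ∧ ∀ (m : ℕ) (hm : 1 ≤ m), 2 * N < m → ∀ (j : ℕ)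
      (x : galoisCohomology (GaloisRep.toLocal v
        (κ.eisensteinTwist (W.torsionGaloisModule ((p : ℤ) ^ j)) hm j)) 1), p ^ (8 * N) • x = 0 := by
  haveI : CharZero (v.adicCompletion K) :=
    charZero_of_injective_algebraMap (algebraMap K (v.adicCompletion K)).injective
  have hpK : (p : K) ≠ 0 := Nat.cast_ne_zero.mpr hp.out.ne_zero
  obtain ⟨h₀, hh₀⟩ : ∃ h₀ : absoluteGaloisGroup (v.adicCompletion K),
      κ (absGaloisRestrict K (v.adicCompletion K) h₀) ≠ 1 := by
    by_contra hall
    push Not at hall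
    exact hdec fun δ hδ ↦ by
      obtain ⟨σ, rfl⟩ := (GreenbergSelmer.mem_decomp_iff v δ).1 hδ
      exact ZpExtension.mem_kerSubgroup.2 (hall σ)
  exact κ.exists_forall_pow_smul_galoisCohomology_one_eq_zero_uniform W (v.adicCompletion K) hpK
    (not_ringChar_residueField_adicCompletion_dvd_of_not_mem v hv) h₀ hh₀

end AdicCompletionUniform

end Literature.NumberTheory.EllipticCurves

end
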